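import Literature.NumberTheory.LFunctions.KMVHighDerivativeNonvanishing
import Literature.NumberTheory.LFunctions.CentralValueForcedZeros
import Literature.NumberTheory.LFunctions.XiTaylor
import Literature.NumberTheory.EllipticCurves.NewformsRealCoefficients
import HarnessLib

/-!
# KMV 2000, Lemma 3.1 (Hecke's recursion at prime level), (22) (the exact AFE of `Λ^{(k)}(f,½)²`) and p. 4
# (reality of `λ_f(n)` and `Λ^{(k)}(f,½)`) — NAMED FACTS as printed; typed ≠ proved

LANDING NOTE (typer ls-idea-typ-1 gen 3, cell ls-idea): typing want W-L17-2 of seat ls-idea-lens-17 (gen 2/3; the seat's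
`W_L17_2_shapes.lean`, «to ls-idea-typ-1»; critic E b7: «land the COMPOSITE identity as the named target, F-AFE2 / F-HECKE as
lemmas toward it») = the printed inputs of stub `stub_identP : TailNearFar rhoP` of the registered D-0145 line
`Summits/Parity/GeneralizedHardyLittlewood/Cruxes/MomentsBeyondDiagonal/Lines/petersson_layers.lean` on K_A (stmt-Parity-20007)
and of the reading of `diagPart` / `layer r` in deck 21a (`…/Theorems/PrimeLevelFamEdgeIdeaDeltasPeterssonLayersSplit.lean`).
Under critic E's RULING T1 («a named fact may not exceed its print») this file carries ONLY what KMV print: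
* `kmv2000_lemma31` = F-HECKE — Lemma 3.1 (10) p. 8 L9–L20: «For m, n ≥ 1 and f ∈ S₂(q)* one has
  λ_f(m)λ_f(n) = Σ_{d|(m,n)} ε_q(d) λ_f(mn/d²) where ε_q is the trivial character modulo q.»
* `kmv2000_eq22` = F-AFE at ONE order `k` — p. 12 L41–L74, (22): «The functional equation for Λ(f, 1/2 + s) has always
  sign +1 so manipulations similar as those performed in the previous section yield
  Λ^{(k)}(f,1/2)² = 2q̂ Σ_{n₁,n₂} λ_f(n₁)λ_f(n₂)(n₁n₂)^{−1/2} × (1/2πi)∫_{(3)} (q̂ᵗΓ(1+t)/n₁ᵗ)^{(k)} (q̂ᵗΓ(1+t)/n₂ᵗ)^{(k)} dt/t.»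
  (with p. 9 L41–L50, (13): for Re s > 1/2, «Λ^{(k)}(f,1/2+s) = Σ_n λ_f(n) q̂^{1/2} n^{−1/2} (q̂ˢΓ(1+s)/nˢ)^{(k)}» — absolute
  convergence on `Re t = 3`, whence the `Summable` clause).
* `kmv2000_p4_real` = F-REAL — p. 4 L63–L64: «since λ_f(n) is real the functional equation is symmetric (the sign ε_f
  excepted), so that the Λ^{(k)}(f, 1/2) are all real.»
NOT FILED HERE (not KMV's words): the seat's TWO-ORDER reading F-AFE2 `Λ^{(i)}(f,½)Λ^{(j)}(f,½) = (1+(−1)^{i+j}) q̂ Σ …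
W_{ij}` (same contour argument applied to `Λ^{(i)}(f,½+t)Λ^{(j)}(f,½+t)`; at `i = j = k` it is (22)) — it stays an UNCITED
shape for the Summits side; `afeW qh i j` below is nevertheless typed for two orders so that (22) is its diagonal `i = j = k`
and the Summits decks 21a–c (whose `afeKernel`/`afeW` are these, in their own namespace) read against one definition.
Vocabulary (tree): `KMV2000.qhat`, `KMV2000.derivLambda q k f = Λ^{(k)}(f,½)`, `GL2Family.heckeLambda f n = a_f(n) n^{−1/2}
= λ_f(n)` (weight 2), `newforms0 q 2 = S₂(q)*`.  Typing checklist: `q` prime (standing assumption §1); one Bochner integral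
(`afeW`, a line integral on `Re t = 3` written over `ℝ`); no hand-picked thresholds; (10) at `m = n = 1` reads `1 = λ_f(1)`,
consistent with `a_f(1) = 1` for `f ∈ S₂(q)*`.  Nothing here is proved about `L`-functions; no summit statement and no
exceptional-zero theorem (no Landau–Siegel / Siegel-zero exclusion, no Theorem 1–2 of arXiv:2211.02515, no repaired
Margin232) is proved by this file; typed ≠ proved; located ≠ endorsed.
-/

noncomputable section

open scoped MatrixGroups Real
open CongruenceSubgroup Complex Finset MeasureTheory
open Literature.NumberTheory.EllipticCurves.ModularForms

namespace Literature.NumberTheory.LFunctions.KMV2000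

/-! ## Lemma 3.1 — Hecke's recursion for `S₂(q)*`, `q` prime -/

/-- **KMV 2000, Lemma 3.1, (10).** Printed: «For m, n ≥ 1 and f ∈ S₂(q)* one has
λ_f(m)λ_f(n) = Σ_{d|(m,n)} ε_q(d) λ_f(mn/d²) where ε_q is the trivial character modulo q» (`ε_q(d) = 1` if `q ∤ d`,
`0` if `q ∣ d`; `q` prime, weight 2, `λ_f(n) = a_f(n)n^{−1/2}` = `GL2Family.heckeLambda f n`).
[cite: KowalskiMichelVanderKam2000, Lemma 3.1 (10) p. 8] -/
def kmv2000_lemma31 : Prop :=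
  ∀ (q : ℕ) [NeZero q], q.Prime → ∀ f ∈ newforms0 q 2, ∀ m n : ℕ, 1 ≤ m → 1 ≤ n →
    GL2Family.heckeLambda f m * GL2Family.heckeLambda f n =
      ∑ d ∈ (Nat.gcd m n).divisors.filter (fun d ↦ ¬ q ∣ d), GL2Family.heckeLambda f (m * n / d ^ 2)

/-- Below the level the character `ε_q` in (10) is void: if `1 ≤ m < q` then every `d ∣ (m, n)` has `q ∤ d`
(KMV p. 13: «since q, the level, is prime, and we have the restriction m₁, m₂ < M … the trivial character ε_q won't
appear»). [cite: KowalskiMichelVanderKam2000, p. 13 (remark after (23))] -/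
theorem filter_not_dvd_eq_divisors {q m n : ℕ} (hm : 1 ≤ m) (hmq : m < q) :
    (Nat.gcd m n).divisors.filter (fun d ↦ ¬ q ∣ d) = (Nat.gcd m n).divisors := by
  apply Finset.filter_true_of_mem
  intro d hd hqd
  have hdpos : d ∣ Nat.gcd m n := Nat.dvd_of_mem_divisors hd
  have hdm : d ∣ m := hdpos.trans (Nat.gcd_dvd_left m n)
  have hdle : d ≤ m := Nat.le_of_dvd (by omega) hdm
  have hqle : q ≤ d := Nat.le_of_dvd (Nat.pos_of_mem_divisors hd) hqd
  omega

/-- (10) below the level, as used on p. 13: for `1 ≤ m < q` the recursion is over ALL `d ∣ (m, n)`.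
[cite: KowalskiMichelVanderKam2000, Lemma 3.1 (10) p. 8 with p. 13] -/
theorem heckeLambda_mul_of_lt_level (h : kmv2000_lemma31) {q : ℕ} [NeZero q] (hq : q.Prime)
    {f : CuspForm (Gamma0 q) 2} (hf : f ∈ newforms0 q 2) {m n : ℕ} (hm : 1 ≤ m) (hmq : m < q) (hn : 1 ≤ n) :
    GL2Family.heckeLambda f m * GL2Family.heckeLambda f n =
      ∑ d ∈ (Nat.gcd m n).divisors, GL2Family.heckeLambda f (m * n / d ^ 2) := by
  rw [h q hq f hf m n hm hn, filter_not_dvd_eq_divisors hm hmq]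

/-! ## (21)–(22) — the exact approximate functional equation of `Λ^{(k)}(f,½)²` -/

/-- `D_i(q̂; n, s) := ∂ⁱ/∂sⁱ [ q̂ˢ Γ(1+s) n^{−s} ]` — the `i`-th derivative of the summand kernel of (13)/(22).
[cite: KowalskiMichelVanderKam2000, (13) p. 9 and (22) p. 12 (the kernel `(q̂ᵗΓ(1+t)n^{−t})^{(k)}`)] -/
def afeKernel (qh : ℝ) (i n : ℕ) (s : ℂ) : ℂ :=
  iteratedDeriv i (fun s : ℂ ↦ ((qh : ℂ) ^ s) * Complex.Gamma (1 + s) * ((n : ℂ) ^ (-s))) s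

/-- `W_{ij}(q̂; n₁, n₂) := (1/2πi) ∫_{(3)} D_i(q̂;n₁,t) D_j(q̂;n₂,t) dt/t = (1/2π) ∫_ℝ D_i(3+iy) D_j(3+iy) (3+iy)⁻¹ dy`
(the contour `Re t = 3` of (22), parametrised `t = 3 + iy`; two orders `i, j` so that (22) is the diagonal `i = j = k`).
[cite: KowalskiMichelVanderKam2000, (22) p. 12 (the weight integral, at i = j = k)] -/
def afeW (qh : ℝ) (i j n₁ n₂ : ℕ) : ℂ :=
  (1 / (2 * π) : ℂ) * ∫ y : ℝ, afeKernel qh i n₁ (3 + y * I) * afeKernel qh j n₂ (3 + y * I) / (3 + y * I)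

/-- The `(n₁, n₂)` summand `λ_f(n₁)λ_f(n₂)(n₁n₂)^{−1/2} W_{ij}(q̂;n₁,n₂)` of (22) (two orders), set to `0` when `n₁ = 0` or
`n₂ = 0` so that the series is indexed by `ℕ × ℕ`. [cite: KowalskiMichelVanderKam2000, (22) p. 12 (summand, at i = j = k)] -/
def afeTerm (q : ℕ) [NeZero q] (f : CuspForm (Gamma0 q) 2) (i j n₁ n₂ : ℕ) : ℂ :=
  if n₁ = 0 ∨ n₂ = 0 then 0 else
    GL2Family.heckeLambda f n₁ * GL2Family.heckeLambda f n₂ *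
      ((((n₁ : ℝ) * n₂) ^ (-(1 / 2 : ℝ)) : ℝ) : ℂ) * afeW (qhat q) i j n₁ n₂

/-- **KMV 2000, (22) (with (21): «The functional equation for Λ(f, 1/2 + s) has always sign +1»).** Printed:
«Λ^{(k)}(f,1/2)² = 2q̂ Σ_{n₁,n₂} λ_f(n₁)λ_f(n₂)(n₁n₂)^{−1/2} × (1/2πi)∫_{(3)} (q̂ᵗΓ(1+t)/n₁ᵗ)^{(k)} (q̂ᵗΓ(1+t)/n₂ᵗ)^{(k)} dt/t»
for `q` prime, `f ∈ S₂(q)*`, `k ≥ 0` — an EXACT identity («a rapidly convergent series», p. 12 L41; the double series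
converges absolutely by (13) on `Re t = 3`, typed as the `Summable` clause).  ONE order `k` only: the two-order variant
`Λ^{(i)}Λ^{(j)} = (1+(−1)^{i+j}) q̂ Σ … W_{ij}` is NOT printed and NOT part of this fact.
[cite: KowalskiMichelVanderKam2000, (21)–(22) p. 12] -/
def kmv2000_eq22 : Prop :=
  ∀ (q : ℕ) [NeZero q], q.Prime → ∀ f ∈ newforms0 q 2, ∀ k : ℕ,
    Summable (fun n : ℕ × ℕ ↦ ‖afeTerm q f k k n.1 n.2‖) ∧
      derivLambda q k f ^ 2 = 2 * (qhat q : ℂ) * ∑' n : ℕ × ℕ, afeTerm q f k k n.1 n.2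

/-! ## p. 4 — reality -/

/-- **KMV 2000, p. 4.** Printed: «since λ_f(n) is real the functional equation is symmetric (the sign ε_f excepted), so
that the Λ^{(k)}(f, 1/2) are all real» (`q` prime, `f ∈ S₂(q)*`): the Hecke eigenvalues `λ_f(n)` and every central
derivative `Λ^{(k)}(f,½)` are real — so `|Q̃Λ(f) M_P(f)|² = (Q̃Λ(f) M_P(f))²` in `KMV2000.QhPQ`.
[cite: KowalskiMichelVanderKam2000, p. 4 (paragraph before §2)] -/
def kmv2000_p4_real : Prop :=
  ∀ (q : ℕ) [NeZero q], q.Prime → ∀ f ∈ newforms0 q 2,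
    (∀ n : ℕ, (GL2Family.heckeLambda f n).im = 0) ∧ ∀ k : ℕ, (derivLambda q k f).im = 0

/-- Under `kmv2000_p4_real` the square in (22) is the squared modulus: `Λ^{(k)}(f,½)² = ‖Λ^{(k)}(f,½)‖²`.
[cite: KowalskiMichelVanderKam2000, p. 4 with (22) p. 12] -/
theorem derivLambda_sq_eq_norm_sq (h : kmv2000_p4_real) {q : ℕ} [NeZero q] (hq : q.Prime)
    {f : CuspForm (Gamma0 q) 2} (hf : f ∈ newforms0 q 2) (k : ℕ) :
    derivLambda q k f ^ 2 = ((‖derivLambda q k f‖ ^ 2 : ℝ) : ℂ) := by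
  have him : (derivLambda q k f).im = 0 := (h q hq f hf).2 k
  rw [← Complex.re_add_im (derivLambda q k f), him]
  simp only [Complex.ofReal_zero, zero_mul, add_zero]
  rw [← Complex.ofReal_pow, Complex.norm_real, Real.norm_eq_abs, sq_abs]


/-! ## p. 4 — reality DISCHARGED (typer ls-idea-typ-1 gen 3, appended): `kmv2000_p4_real_holds`

From the tree: the Fourier coefficients of a newform on `Γ₀(N)` are real (`IsNewform0.conj_cuspCoeff`, PROVED in
`NewformsRealCoefficients`), the entire continuation of `L(f,s)` exists and is unique (`IwaniecSarnak.entireLSeries`,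
`nonempty_LSeriesContinuations_cuspCoeff`, `subsingleton_LSeriesContinuations`), so by the reflection principle
`Λ(f, s̄) = conj Λ(f, s)` and every derivative of `Λ(f,·)` at the real point `½` is real
(`iteratedDeriv_conj_of_conj`).  No hypothesis on `q` beyond `f ∈ S₂(q)*` is used. -/

open ComplexConjugate

/-- `λ_f(n) = a_f(n) n^{−1/2}` is real for a newform `f ∈ S₂(q)*` (real Fourier coefficients, tree). [cite: KowalskiMichelVanderKam2000, p. 4 («λ_f(n) is real»)] -/
theorem heckeLambda_im_eq_zero {q : ℕ} [NeZero q] {f : CuspForm (Gamma0 q) 2} (hf : f ∈ newforms0 q 2) (n : ℕ) :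
    (GL2Family.heckeLambda f n).im = 0 := by
  have hf' : IsNewform0 f := hf
  rw [GL2Family.heckeLambda_def]
  have hexp : (-(((((2 : ℤ) : ℂ)) - 1) / 2) : ℂ) = ((-(1 / 2 : ℝ) : ℝ) : ℂ) := by push_cast; ring
  rw [hexp, ← Complex.ofReal_natCast, ← Complex.ofReal_cpow (Nat.cast_nonneg n), Complex.mul_im,
    Complex.ofReal_re, Complex.ofReal_im, hf'.cuspCoeff_im_eq_zero n]
  ring

/-- The `L`-series of a newform on `Γ₀(q)` commutes with conjugation: `L(f, s̄) = conj L(f, s)` on all of `ℂ`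
(real coefficients; `conj` commutes with `tsum`). [cite: KowalskiMichelVanderKam2000, p. 4 («since λ_f(n) is real the functional equation is symmetric»)] -/
theorem LSeries_cuspCoeff_conj {q : ℕ} [NeZero q] {f : CuspForm (Gamma0 q) 2} (hf : IsNewform0 f) (s : ℂ) :
    LSeries (cuspCoeff f) (conj s) = conj (LSeries (cuspCoeff f) s) := by
  simp only [LSeries]
  rw [Complex.conj_tsum]
  refine tsum_congr fun n => ?_
  rcases Nat.eq_zero_or_pos n with rfl | hn
  · simp [LSeries.term]
  · rw [LSeries.term_of_ne_zero hn.ne', LSeries.term_of_ne_zero hn.ne', map_div₀, hf.conj_cuspCoeff n]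
    congr 1
    have harg : ((n : ℂ)).arg ≠ Real.pi := by
      rw [Complex.natCast_arg]
      exact Real.pi_pos.ne
    have h := Complex.conj_cpow (n : ℂ) (conj s) harg
    rw [Complex.conj_conj, map_natCast] at h
    exact h

/-- **Reflection principle for the entire continuation**: `E(s̄) = conj E(s)` for
`E = IwaniecSarnak.entireLSeries (cuspCoeff f) 2`, `f` a newform of weight 2 (uniqueness of the continuation:
`s ↦ conj E(s̄)` is entire and agrees with the `L`-series on `Re s > 2`). [cite: KowalskiMichelVanderKam2000, p. 4 («the functional equation is symmetric»)] -/
theorem entireLSeries_cuspCoeff_conj {q : ℕ} [NeZero q] {f : CuspForm (Gamma0 q) 2} (hf : IsNewform0 f) (s : ℂ) :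
    IwaniecSarnak.entireLSeries (cuspCoeff f) 2 (conj s) =
      conj (IwaniecSarnak.entireLSeries (cuspCoeff f) 2 s) := by
  have hne : (IwaniecSarnak.LSeriesContinuations (cuspCoeff f) 2).Nonempty := by
    have := IwaniecSarnak.nonempty_LSeriesContinuations_cuspCoeff (k := 2) f
    norm_num at this
    exact this
  set E : ℂ → ℂ := IwaniecSarnak.entireLSeries (cuspCoeff f) 2 with hE
  have hEmem : E ∈ IwaniecSarnak.LSeriesContinuations (cuspCoeff f) 2 := by
    rw [hE, IwaniecSarnak.entireLSeries, dif_pos hne]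
    exact hne.some_mem
  set g : ℂ → ℂ := fun z => conj (E (conj z)) with hg
  have hgmem : g ∈ IwaniecSarnak.LSeriesContinuations (cuspCoeff f) 2 := by
    refine ⟨?_, ?_⟩
    · intro z
      have hd : DifferentiableAt ℂ E (conj z) := hEmem.1 _
      have h2 := hd.conj_conj
      rw [Complex.conj_conj] at h2
      exact h2
    · intro z hz
      have hz' : (2 : ℝ) < (conj z).re := by rwa [Complex.conj_re]
      show conj (E (conj z)) = LSeries (cuspCoeff f) z
      rw [hEmem.2 _ hz', LSeries_cuspCoeff_conj hf, Complex.conj_conj]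
  have heq : g = E := IwaniecSarnak.subsingleton_LSeriesContinuations _ _ hgmem hEmem
  have := congrFun heq (conj s)
  simp only [hg, Complex.conj_conj] at this
  exact this.symm

/-- **`Λ(f, s̄) = conj Λ(f, s)`** for the completed `L`-function `KMV2000.completedL` of a weight-2 newform of level
`q` (`q̂ > 0` real, `Γ(s̄) = conj Γ(s)`, and `entireLSeries_cuspCoeff_conj`). [cite: KowalskiMichelVanderKam2000, p. 4 («the functional equation is symmetric … so that the Λ^{(k)}(f,1/2) are all real»)] -/
theorem completedL_conj {q : ℕ} [NeZero q] {f : CuspForm (Gamma0 q) 2} (hf : IsNewform0 f) (s : ℂ) :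
    completedL q f (conj s) = conj (completedL q f s) := by
  unfold completedL
  have hq : 0 ≤ qhat q := by unfold qhat; positivity
  have harg : (((qhat q : ℝ) : ℂ)).arg ≠ Real.pi := by
    rw [Complex.arg_ofReal_of_nonneg hq]
    exact Real.pi_pos.ne
  have h1 : ((qhat q : ℝ) : ℂ) ^ conj s = conj (((qhat q : ℝ) : ℂ) ^ s) := by
    have h := Complex.conj_cpow ((qhat q : ℝ) : ℂ) (conj s) harg
    rw [Complex.conj_conj, Complex.conj_ofReal] at h
    exact h
  have h2 : conj s + 1 / 2 = conj (s + 1 / 2) := by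
    rw [map_add, map_div₀, map_one, map_ofNat]
  rw [h1, h2, Complex.Gamma_conj, entireLSeries_cuspCoeff_conj hf, map_mul, map_mul]

/-- **KMV 2000, p. 4 — PROVED**: for `q` prime (indeed for every level) and `f ∈ S₂(q)*`, the Hecke eigenvalues
`λ_f(n)` and every central derivative `Λ^{(k)}(f,½)` are real. [cite: KowalskiMichelVanderKam2000, p. 4 (paragraph before §2)] -/
theorem kmv2000_p4_real_holds : kmv2000_p4_real := by
  intro q _ _ f hf
  have hf' : IsNewform0 f := hf
  refine ⟨heckeLambda_im_eq_zero hf, fun k => ?_⟩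
  have hsym : ∀ s, completedL q f (conj s) = conj (completedL q f s) := completedL_conj hf'
  have h := Literature.NumberTheory.LFunctions.iteratedDeriv_conj_of_conj hsym k (1 / 2)
  have hhalf : conj (1 / 2 : ℂ) = 1 / 2 := by rw [map_div₀, map_one, map_ofNat]
  rw [hhalf] at h
  unfold derivLambda
  exact Complex.conj_eq_iff_im.mp h.symm

end Literature.NumberTheory.LFunctions.KMV2000

end
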